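import Literature.Analysis.FluidPDE.LocalPressureLiouvilleKernel
import Literature.Analysis.FluidPDE.LocalLeraySolutionsSlab
import Literature.Analysis.FluidPDE.SpaceTimeMollifier
import Literature.Analysis.FluidPDE.DistributionalToWeak
import Literature.Analysis.FluidPDE.LerayPressureDecayProofs
import HarnessLib

/-!
# The mollified pressure-gradient functional of a local Leray solution on a slab:
integrability, continuity, and decay at spatial infinity

Analysis/FluidPDE support file (theorems only, everything PROVED) on the discharge path of the
named fact `Literature.Analysis.FluidPDE.kangMiuraTsai_local_pressure_bound`
(`LocalLerayPressureBound.lean`; Kang–Miura–Tsai, IMRN 2021 = arXiv:1812.10509, the bound in the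
proof of Lemma 3.4, §8), second layer above `LocalPressureLiouvilleKernel.lean`.

Let `(v, π)` be a local Leray solution on the slab `(0, T) × ℝ³` (`IsLocalLeraySolutionOn`). The
Liouville argument of Fernández-Dalgo–Lemarié-Rieusset (DCDS-S 14 (2021), Thm. 1, §5: the
difference between the pressure gradient and the gradient of the explicit "local + far"
pressure is harmonic in `x`, tempered, hence zero) is run in the tree on the **mollified
pressure-gradient functional**

  `F(c) = ∫∫_{(0,T)×ℝ³} η(t) [ π(t,x) ∂ₑλ_δ(c - x) + D³Φ_δ(c - x)(e)(v(t,x), v(t,x)) ] dx dt`,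

`η ∈ C_c^∞((0,T))` a time test function, `e` a direction, `Φ_δ = newtonReg δ` the regularised
Newtonian kernel and `λ_δ = ΔΦ_δ` its Laplacian (a smooth radial bump of unit mass supported in
`|z| ≤ δ`): the first term is the pressure paired with the gradient of the translated bump, the
second is (minus) the same pairing for the explicit whole-space pressure
`RᵢRⱼ(vᵢvⱼ)`, written through its smooth potential (`D²Φ_δ = λ_δ ⋆ D²Γ`). This file establishes
the analytic standing of `F`:

* `IsLocalLeraySolutionOn.integrable_pgIntegrand` — the integrand is integrable on the slab
  (the pressure term is compactly supported inside the open slab, where `π ∈ L¹_loc`; the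
  velocity term is `O((1+|x-c|)⁻⁴ |v|²)`, integrable by the uniformly local energy bound);
* `IsLocalLeraySolutionOn.continuous_pgFunctional` — `F` is continuous (dominated convergence);
* `IsLocalLeraySolutionOn.pgFunctional_pressure_eq_momentum` — **the only use of the Navier–Stokes
  equations on this route**: testing the momentum equation with `Φ(t,x) = η(t)λ_δ(c - x) e` turns
  the pressure term into `∫∫ [η'λ_δ(c-x)⟨v,e⟩ - η Dλ_δ(c-x)(v)⟨v,e⟩ + ν η Δλ_δ(c-x)⟨v,e⟩]`;
* `IsLocalLeraySolutionOn.tendsto_pgFunctional_cocompact` — **`F(c) → 0` as `|c| → ∞`**, from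
  Jia–Šverák's decay clause (7) of the class (`∫₀ᵀ∫_{B_R(c)} |v|² → 0`): directly for the
  momentum terms (with Cauchy–Schwarz for the term linear in `v`), and through the far-field
  splitting `|x - c| < L` / `≥ L` with the uniformly local tail
  (`lintegral_compl_ball_mul_powKer_le`, `tendsto_lintegral_compl_ball_powKer_four_atTop`) for
  the velocity term.

The harmonicity of the mollifications of `F`, the Liouville step and the time slicing are in
the sequel `LocalPressureLiouville.lean`.

## Mathlib / tree search

Tree: `IsLocalLeraySolutionOn` (`LocalLeraySolutionsSlab`), `newtonReg`, `laplacian_newtonReg`,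
`laplacian_newtonReg_eq_zero` (`NormalisedPressureL2Bound`), `hasCompactSupport_newtonFarLaplacian`,
`contDiff_newtonFarLaplacian` (`NewtonKernel`), `timeDeriv_smul_const`, `convect_smul_const`,
`divergence_smul_const`, `laplacian_smul_const` (`SpaceTimeMollifier`), `fderiv_comp_const_sub`,
`laplacian_comp_const_sub` (`HarmonicProbe`), `isSpaceTimeTestOn_slab_smul` (`DistributionalToWeak`),
`lintegral_compl_ball_mul_powKer_le` (`LerayPressureDecayProofs`),
`tendsto_lintegral_compl_ball_powKer_four_atTop` (`LocalPressureFarFieldTools`), and the kernel toolkit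
`LocalPressureLiouvilleKernel`. Mathlib: `continuousAt_of_dominated`, `integral_prod`,
`lintegral_prod`, `ENNReal.lintegral_mul_le_Lp_mul_Lq`, `Filter.Tendsto` on `cocompact`.

## References

* P. G. Fernández-Dalgo, P. G. Lemarié-Rieusset, DCDS-S 14 (2021) = arXiv:2001.10436, Thm. 1,
  §5. [`FernandezdalgoLemarierieusset2021`]
* K. Kang, H. Miura, T.-P. Tsai, IMRN 2021 = arXiv:1812.10509, Def. 3.2, Lemma 3.4, §8.
  [`KangMiuraTsai2020`]
* H. Jia, V. Šverák, Invent. Math. 196 (2014) = arXiv:1204.0529, §3 (the decay condition in the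
  definition of local Leray solutions "allows us to calculate `p`"). [`JiaSverak2014`]
-/

noncomputable section

open MeasureTheory Set Filter Topology Function Metric
open scoped ENNReal NNReal RealInnerProductSpace Laplacian

namespace Literature.Analysis.FluidPDE

-- nested operator types `ℝ³ →L[ℝ] ℝ³ →L[ℝ] ℝ³ →L[ℝ] ℝ`
set_option maxSynthPendingDepth 3

/-! ## The bump `λ_δ = ΔΦ_δ` -/

section Bump

variable {δ : ℝ}

/-- `λ_δ = ΔΦ_δ` is smooth. [folklore] -/
theorem contDiff_laplacian_newtonReg (hδ : 0 < δ) {n : ℕ∞} : ContDiff ℝ n (Δ (newtonReg δ)) := by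
  rw [laplacian_newtonReg hδ]
  exact contDiff_newtonFarLaplacian (half_pos_lt hδ).1 (half_pos_lt hδ).2

/-- `λ_δ` has compact support. [folklore] -/
theorem hasCompactSupport_laplacian_newtonReg (hδ : 0 < δ) :
    HasCompactSupport (Δ (newtonReg δ)) := by
  rw [laplacian_newtonReg hδ]
  exact hasCompactSupport_newtonFarLaplacian (half_pos_lt hδ).1.le (half_pos_lt hδ).2

/-- `λ_δ` is supported in the closed ball of radius `δ`. [folklore] -/
theorem tsupport_laplacian_newtonReg_subset (hδ : 0 < δ) :
    tsupport (Δ (newtonReg δ)) ⊆ closedBall (0 : EuclideanSpace ℝ (Fin 3)) δ := by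
  rw [laplacian_newtonReg hδ]
  exact (tsupport_newtonFarLaplacian_subset_annulus (half_pos_lt hδ).1.le
    (half_pos_lt hδ).2).trans sdiff_subset

/-- `λ_δ` vanishes identically near every point off the closed ball of radius `δ`. [folklore] -/
theorem laplacian_newtonReg_eventuallyEq_zero (hδ : 0 < δ) {z : EuclideanSpace ℝ (Fin 3)}
    (hz : δ < ‖z‖) : Δ (newtonReg δ) =ᶠ[𝓝 z] fun _ => 0 := by
  have hopen : IsOpen {w : EuclideanSpace ℝ (Fin 3) | δ < ‖w‖} :=
    isOpen_lt continuous_const continuous_norm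
  filter_upwards [hopen.mem_nhds hz] with w hw
  exact laplacian_newtonReg_eq_zero hδ hw

/-- The gradient of `λ_δ` vanishes off the closed ball of radius `δ`. [folklore] -/
theorem fderiv_laplacian_newtonReg_eq_zero (hδ : 0 < δ) {z : EuclideanSpace ℝ (Fin 3)}
    (hz : δ < ‖z‖) : fderiv ℝ (Δ (newtonReg δ)) z = 0 := by
  rw [(laplacian_newtonReg_eventuallyEq_zero hδ hz).fderiv_eq]
  exact fderiv_const_apply 0

/-- Bounds for `λ_δ`, `Dλ_δ`, `Δλ_δ` (continuous functions of compact support). [folklore] -/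
theorem exists_bounds_laplacian_newtonReg (hδ : 0 < δ) :
    ∃ M₀ M₁ M₂ : ℝ, 0 ≤ M₀ ∧ 0 ≤ M₁ ∧ 0 ≤ M₂ ∧ (∀ z, ‖Δ (newtonReg δ) z‖ ≤ M₀) ∧
      (∀ z, ‖fderiv ℝ (Δ (newtonReg δ)) z‖ ≤ M₁) ∧ (∀ z, ‖Δ (Δ (newtonReg δ)) z‖ ≤ M₂) := by
  have hc : ContDiff ℝ 2 (Δ (newtonReg δ)) := contDiff_laplacian_newtonReg hδ
  have hs := hasCompactSupport_laplacian_newtonReg hδ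
  obtain ⟨M₀, hM₀⟩ := hc.continuous.bounded_above_of_compact_support hs
  obtain ⟨M₁, hM₁⟩ := (hc.continuous_fderiv (by norm_num)).bounded_above_of_compact_support
    (hs.fderiv (𝕜 := ℝ))
  obtain ⟨M₂, hM₂⟩ := (FluidPDE.continuous_laplacian hc).bounded_above_of_compact_support
    (hs.mono' fun z hz => by
      contrapose! hz
      simp [FluidPDE.laplacian_eq_zero_of_notMem_tsupport hz])
  exact ⟨max M₀ 0, max M₁ 0, max M₂ 0, le_max_right _ _, le_max_right _ _, le_max_right _ _,
    fun z => (hM₀ z).trans (le_max_left _ _), fun z => (hM₁ z).trans (le_max_left _ _),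
    fun z => (hM₂ z).trans (le_max_left _ _)⟩

end Bump

/-! ## Measurability of diagonal pairings on a general measure space -/

section Meas

variable {α : Type*} [MeasurableSpace α] {μ : Measure α}

/-- Measurability of `a ↦ K(a)(w a, w a)` for a.e.-strongly measurable `w` and `K` (general
measure space; the `ℝ³`-version is `aestronglyMeasurable_evalDiag_apply`). [folklore] -/
theorem aestronglyMeasurable_evalDiag_apply' {w : α → EuclideanSpace ℝ (Fin 3)}
    (hw : AEStronglyMeasurable w μ)
    {K : α → EuclideanSpace ℝ (Fin 3) →L[ℝ] EuclideanSpace ℝ (Fin 3) →L[ℝ] ℝ}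
    (hK : AEStronglyMeasurable K μ) :
    AEStronglyMeasurable (fun a => evalDiag (w a) (K a)) μ := by
  have h1 : Continuous fun p : EuclideanSpace ℝ (Fin 3) ×
      (EuclideanSpace ℝ (Fin 3) →L[ℝ] EuclideanSpace ℝ (Fin 3) →L[ℝ] ℝ) => p.2 p.1 :=
    isBoundedBilinearMap_apply.continuous.comp (continuous_snd.prodMk continuous_fst)
  have hΨ : Continuous fun p : EuclideanSpace ℝ (Fin 3) ×
      (EuclideanSpace ℝ (Fin 3) →L[ℝ] EuclideanSpace ℝ (Fin 3) →L[ℝ] ℝ) => p.2 p.1 p.1 :=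
    isBoundedBilinearMap_apply.continuous.comp (h1.prodMk continuous_fst)
  exact hΨ.comp_aestronglyMeasurable (hw.prodMk hK)

end Meas

/-! ## The slab: measures, slices, the uniformly local energy -/

section Slab

variable {T ν : ℝ} {v₀ : EuclideanSpace ℝ (Fin 3) → EuclideanSpace ℝ (Fin 3)}
  {v : ℝ → EuclideanSpace ℝ (Fin 3) → EuclideanSpace ℝ (Fin 3)}
  {π : ℝ → EuclideanSpace ℝ (Fin 3) → ℝ}

/-- The underlying set of the slab `(0, T) × ℝ³`. [folklore] -/
theorem coe_slab_Ioo (T : ℝ) :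
    ((slab (EuclideanSpace ℝ (Fin 3)) (Ioo 0 T) isOpen_Ioo :
      TopologicalSpace.Opens (ℝ × EuclideanSpace ℝ (Fin 3))) : Set (ℝ × EuclideanSpace ℝ (Fin 3))) =
      Ioo (0 : ℝ) T ×ˢ univ := rfl

namespace IsLocalLeraySolutionOn

/-- The pressure of a local Leray solution is a.e.-strongly measurable on the slab. [folklore] -/
theorem aestronglyMeasurable_pressure (hv : IsLocalLeraySolutionOn T ν v₀ v π) :
    AEStronglyMeasurable (uncurry π)
      (volume.restrict (Ioo (0 : ℝ) T ×ˢ (univ : Set (EuclideanSpace ℝ (Fin 3))))) :=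
  hv.distributional.2.2.1.aestronglyMeasurable

/-- The velocity is a.e.-strongly measurable for the product form of the slab measure. [folklore] -/
theorem aestronglyMeasurable_prod (hv : IsLocalLeraySolutionOn T ν v₀ v π) :
    AEStronglyMeasurable (uncurry v)
      (((volume : Measure ℝ).restrict (Ioo 0 T)).prod
        (volume : Measure (EuclideanSpace ℝ (Fin 3)))) := by
  rw [← volume_restrict_slab_eq_prod]
  exact hv.aestronglyMeasurable

/-- Almost every time slice of the velocity is a.e.-strongly measurable. [folklore] -/
theorem ae_aestronglyMeasurable_slice' (hv : IsLocalLeraySolutionOn T ν v₀ v π) :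
    ∀ᵐ t ∂(volume.restrict (Ioo (0 : ℝ) T)), AEStronglyMeasurable (v t) volume := by
  filter_upwards [hv.aestronglyMeasurable_prod.prodMk_left] with t ht
  exact ht

/-- **The uniformly local energy against the weight `(1 + |x - c|)⁻⁴`, on the slab.** For a
local Leray solution on `(0,T) × ℝ³` with `∫_{B_1(x₀)} |v(t)|² ≤ A` for a.e. `t` and all `x₀`,
`∫∫_{(0,T)×ℝ³} (1 + |x - c|)⁻⁴ |v|² ≤ C A |(0,T)|` with the constant `C` of
`exists_lintegral_mul_inv_one_add_norm_pow_le`. [folklore] -/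
theorem lintegral_slab_weight_mul_le (hv : IsLocalLeraySolutionOn T ν v₀ v π) {C : ℝ≥0∞}
    (hC : ∀ (g : EuclideanSpace ℝ (Fin 3) → ℝ≥0∞), AEMeasurable g volume → ∀ (A : ℝ≥0∞),
      (∀ z : EuclideanSpace ℝ (Fin 3), ∫⁻ y in ball z 1, g y ≤ A) → ∀ x₀ : EuclideanSpace ℝ (Fin 3),
        ∫⁻ y, g y * ENNReal.ofReal (((1 + ‖y - x₀‖) ^ 4)⁻¹) ≤ C * A)
    {A : ℝ≥0∞} (hA : ∀ᵐ t ∂(volume.restrict (Ioo (0 : ℝ) T)),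
      ∀ x₀ : EuclideanSpace ℝ (Fin 3), ∫⁻ y in ball x₀ 1, ‖v t y‖ₑ ^ 2 ≤ A)
    (c : EuclideanSpace ℝ (Fin 3)) :
    ∫⁻ z in Ioo (0 : ℝ) T ×ˢ (univ : Set (EuclideanSpace ℝ (Fin 3))),
        ‖v z.1 z.2‖ₑ ^ 2 * ENNReal.ofReal (((1 + ‖z.2 - c‖) ^ 4)⁻¹) ≤
      C * A * volume (Ioo (0 : ℝ) T) := by
  set μt : Measure ℝ := volume.restrict (Ioo (0 : ℝ) T) with hμt
  have hvm := hv.aestronglyMeasurable_prod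
  have hFm : AEMeasurable (fun z : ℝ × EuclideanSpace ℝ (Fin 3) =>
      ‖v z.1 z.2‖ₑ ^ 2 * ENNReal.ofReal (((1 + ‖z.2 - c‖) ^ 4)⁻¹)) (μt.prod volume) :=
    (hvm.enorm.pow_const 2).mul
      ((measurable_ofReal_inv_one_add_norm_sub_pow c).comp measurable_snd).aemeasurable
  rw [volume_restrict_slab_eq_prod, lintegral_prod _ hFm]
  have hslice : ∀ᵐ t ∂μt, ∫⁻ x, ‖v t x‖ₑ ^ 2 * ENNReal.ofReal (((1 + ‖x - c‖) ^ 4)⁻¹) ≤ C * A := by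
    filter_upwards [hA, hv.ae_aestronglyMeasurable_slice'] with t ht hmt
    exact hC (fun x => ‖v t x‖ₑ ^ 2) (hmt.enorm.pow_const 2) A ht c
  calc ∫⁻ t, (∫⁻ x : EuclideanSpace ℝ (Fin 3),
        ‖v t x‖ₑ ^ 2 * ENNReal.ofReal (((1 + ‖x - c‖) ^ 4)⁻¹)) ∂μt
      ≤ ∫⁻ _t, C * A ∂μt := lintegral_mono_ae hslice
    _ = C * A * volume (Ioo (0 : ℝ) T) := by rw [lintegral_const, hμt, Measure.restrict_apply_univ]

/-- **Integrability of the weighted energy on the slab**: `(1 + |x - c|)⁻⁴ |v(t,x)|²` is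
integrable on `(0,T) × ℝ³` for a local Leray solution (uniformly local energy a.e. in time).
[folklore] -/
theorem integrable_slab_weight_mul_norm_sq (hv : IsLocalLeraySolutionOn T ν v₀ v π)
    (c : EuclideanSpace ℝ (Fin 3)) :
    Integrable (fun z : ℝ × EuclideanSpace ℝ (Fin 3) => ((1 + ‖z.2 - c‖) ^ 4)⁻¹ * ‖v z.1 z.2‖ ^ 2)
      (volume.restrict (Ioo (0 : ℝ) T ×ˢ (univ : Set (EuclideanSpace ℝ (Fin 3))))) := by
  obtain ⟨Cw, hCwtop, hCw⟩ := exists_lintegral_mul_inv_one_add_norm_pow_le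
  obtain ⟨A, hA⟩ := hv.uniformLocalEnergy 1 one_pos
  have hm : AEStronglyMeasurable
      (fun z : ℝ × EuclideanSpace ℝ (Fin 3) => ((1 + ‖z.2 - c‖) ^ 4)⁻¹ * ‖v z.1 z.2‖ ^ 2)
      (volume.restrict (Ioo (0 : ℝ) T ×ˢ (univ : Set (EuclideanSpace ℝ (Fin 3))))) := by
    refine AEStronglyMeasurable.mul (Measurable.aestronglyMeasurable (by fun_prop)) ?_
    exact (continuous_norm.pow 2).comp_aestronglyMeasurable hv.aestronglyMeasurable
  have hnn : ∀ z : ℝ × EuclideanSpace ℝ (Fin 3), 0 ≤ ((1 + ‖z.2 - c‖) ^ 4)⁻¹ * ‖v z.1 z.2‖ ^ 2 :=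
    fun z => by positivity
  refine ⟨hm, ?_⟩
  rw [hasFiniteIntegral_iff_ofReal (Eventually.of_forall hnn)]
  have key := hv.lintegral_slab_weight_mul_le hCw hA c
  refine lt_of_le_of_lt (le_trans (le_of_eq (lintegral_congr fun z => ?_)) key) ?_
  · rw [ENNReal.ofReal_mul (by positivity), mul_comm, ← ofReal_norm,
      ← ENNReal.ofReal_pow (norm_nonneg _)]
  · rw [Real.volume_Ioo]
    exact ENNReal.mul_lt_top (ENNReal.mul_lt_top hCwtop.lt_top ENNReal.coe_lt_top)
      ENNReal.ofReal_lt_top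

end IsLocalLeraySolutionOn

end Slab

/-! ## The functional: integrability and continuity -/

section Functional

variable {T ν : ℝ} {v₀ : EuclideanSpace ℝ (Fin 3) → EuclideanSpace ℝ (Fin 3)}
  {v : ℝ → EuclideanSpace ℝ (Fin 3) → EuclideanSpace ℝ (Fin 3)}
  {π : ℝ → EuclideanSpace ℝ (Fin 3) → ℝ} {δ : ℝ} {η : ℝ → ℝ}

/-- A time profile `η` supported in `(0, T)` and the bump `λ_δ(c - ·)` give a product supported in
the compact subset `tsupport η × B̄(c₀, r)` of the open slab whenever `B̄(c, δ) ⊆ B̄(c₀, r)`: the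
pressure term of the functional vanishes off this set. [folklore] -/
theorem pressure_term_eq_zero_of_notMem (hδ : 0 < δ) {c c₀ : EuclideanSpace ℝ (Fin 3)} {r : ℝ}
    (hcr : closedBall c δ ⊆ closedBall c₀ r) (π : ℝ → EuclideanSpace ℝ (Fin 3) → ℝ)
    (e : EuclideanSpace ℝ (Fin 3)) {z : ℝ × EuclideanSpace ℝ (Fin 3)}
    (hz : z ∉ tsupport η ×ˢ closedBall c₀ r) :
    η z.1 * (π z.1 z.2 * fderiv ℝ (Δ (newtonReg δ)) (c - z.2) e) = 0 := by
  rw [Set.mem_prod, not_and_or] at hz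
  rcases hz with h | h
  · rw [image_eq_zero_of_notMem_tsupport h, zero_mul]
  · have h' : z.2 ∉ closedBall c δ := fun h' => h (hcr h')
    rw [mem_closedBall, dist_eq_norm, not_le, ← norm_sub_rev] at h'
    rw [fderiv_laplacian_newtonReg_eq_zero hδ h', _root_.zero_apply, mul_zero,
      mul_zero]

namespace IsLocalLeraySolutionOn

/-- **Integrability of the pressure term** `η(t) π(t,x) ∂ₑλ_δ(c - x)` on the slab: it is bounded
by `‖η‖_∞ ‖Dλ_δ‖_∞ |e| |π|` on the compact set `tsupport η × B̄(c₀, r) ⊂ (0,T) × ℝ³`, outside of which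
it vanishes, and `π ∈ L¹_loc` of the open slab. [folklore] -/
theorem integrable_pressure_term (hv : IsLocalLeraySolutionOn T ν v₀ v π) (hδ : 0 < δ)
    (hη : Continuous η) (hηc : HasCompactSupport η) (hηT : tsupport η ⊆ Ioo 0 T)
    {c c₀ : EuclideanSpace ℝ (Fin 3)} {r : ℝ} (hcr : closedBall c δ ⊆ closedBall c₀ r)
    (e : EuclideanSpace ℝ (Fin 3)) :
    Integrable (fun z : ℝ × EuclideanSpace ℝ (Fin 3) =>
        η z.1 * (π z.1 z.2 * fderiv ℝ (Δ (newtonReg δ)) (c - z.2) e))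
      (volume.restrict (Ioo (0 : ℝ) T ×ˢ (univ : Set (EuclideanSpace ℝ (Fin 3))))) := by
  obtain ⟨M₀, M₁, M₂, -, hM₁0, -, -, hM₁, -⟩ := exists_bounds_laplacian_newtonReg hδ
  obtain ⟨Mη, hMη⟩ := hη.bounded_above_of_compact_support hηc
  set K : Set (ℝ × EuclideanSpace ℝ (Fin 3)) := tsupport η ×ˢ closedBall c₀ r with hK
  have hKc : IsCompact K := hηc.isCompact.prod (isCompact_closedBall _ _)
  have hKQ : K ⊆ Ioo (0 : ℝ) T ×ˢ (univ : Set (EuclideanSpace ℝ (Fin 3))) :=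
    prod_mono hηT (subset_univ _)
  have hπK : IntegrableOn (uncurry π) K volume :=
    hv.distributional.2.2.1.integrableOn_compact_subset hKQ hKc
  -- the continuous factor
  have hcont : Continuous fun z : ℝ × EuclideanSpace ℝ (Fin 3) =>
      η z.1 * fderiv ℝ (Δ (newtonReg δ)) (c - z.2) e :=
    (hη.comp continuous_fst).mul ((((contDiff_laplacian_newtonReg hδ (n := 1)).continuous_fderiv
      one_ne_zero).comp (continuous_const.sub continuous_snd)).clm_apply continuous_const)
  have hbdd : ∀ z : ℝ × EuclideanSpace ℝ (Fin 3),
      ‖η z.1 * fderiv ℝ (Δ (newtonReg δ)) (c - z.2) e‖ ≤ Mη * (M₁ * ‖e‖) := fun z => by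
    rw [norm_mul]
    refine mul_le_mul (hMη _) ?_ (norm_nonneg _) ((norm_nonneg _).trans (hMη 0))
    exact (ContinuousLinearMap.le_opNorm _ _).trans (mul_le_mul_of_nonneg_right (hM₁ _) (norm_nonneg _))
  have hIK : IntegrableOn (fun z : ℝ × EuclideanSpace ℝ (Fin 3) =>
      η z.1 * (π z.1 z.2 * fderiv ℝ (Δ (newtonReg δ)) (c - z.2) e)) K volume := by
    have h1 : IntegrableOn (fun z : ℝ × EuclideanSpace ℝ (Fin 3) =>
        (η z.1 * fderiv ℝ (Δ (newtonReg δ)) (c - z.2) e) * uncurry π z) K volume :=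
      hπK.bdd_mul hcont.aestronglyMeasurable (ae_of_all _ hbdd)
    refine h1.congr_fun (fun z _ => ?_) (hKc.measurableSet)
    simp only [uncurry]
    ring
  have hIK' : IntegrableOn (fun z : ℝ × EuclideanSpace ℝ (Fin 3) =>
      η z.1 * (π z.1 z.2 * fderiv ℝ (Δ (newtonReg δ)) (c - z.2) e)) K
      (volume.restrict (Ioo (0 : ℝ) T ×ˢ (univ : Set (EuclideanSpace ℝ (Fin 3))))) :=
    hIK.mono_measure Measure.restrict_le_self
  exact hIK'.integrable_of_forall_notMem_eq_zero fun z hz =>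
    pressure_term_eq_zero_of_notMem hδ hcr π e hz

/-- **Integrability of the velocity term** `η(t) D³Φ_δ(c - x)(e)(v, v)` on the slab: it is
`O(‖η‖_∞ (1+|x-c|)⁻⁴ |v|²)`. [folklore] -/
theorem integrable_velocity_term (hv : IsLocalLeraySolutionOn T ν v₀ v π) (hδ : 0 < δ)
    (hη : Continuous η) (hηc : HasCompactSupport η) (c e : EuclideanSpace ℝ (Fin 3)) :
    Integrable (fun z : ℝ × EuclideanSpace ℝ (Fin 3) => η z.1 *
        evalDiag (v z.1 z.2) (fderiv ℝ (fderiv ℝ (fderiv ℝ (newtonReg δ))) (c - z.2) e))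
      (volume.restrict (Ioo (0 : ℝ) T ×ˢ (univ : Set (EuclideanSpace ℝ (Fin 3))))) := by
  obtain ⟨C, hC0, hC⟩ := exists_norm_fderiv3_newtonReg_le_inv hδ
  obtain ⟨Mη, hMη⟩ := hη.bounded_above_of_compact_support hηc
  have hMη0 : 0 ≤ Mη := (norm_nonneg _).trans (hMη 0)
  refine Integrable.mono' ((hv.integrable_slab_weight_mul_norm_sq c).const_mul (Mη * (C * ‖e‖)))
    ?_ (Eventually.of_forall fun z => ?_)
  · refine ((hη.comp continuous_fst).aestronglyMeasurable).mul ?_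
    exact aestronglyMeasurable_evalDiag_apply' hv.aestronglyMeasurable
      ((((continuous_fderiv3_newtonReg δ).comp (continuous_const.sub continuous_snd)).clm_apply
        continuous_const).aestronglyMeasurable)
  · rw [norm_mul, norm_sub_rev z.2 c]
    calc ‖η z.1‖ * ‖evalDiag (v z.1 z.2) (fderiv ℝ (fderiv ℝ (fderiv ℝ (newtonReg δ))) (c - z.2) e)‖
        ≤ Mη * (‖evalDiag (v z.1 z.2)‖ *
            ‖fderiv ℝ (fderiv ℝ (fderiv ℝ (newtonReg δ))) (c - z.2) e‖) :=
          mul_le_mul (hMη _) (ContinuousLinearMap.le_opNorm _ _) (norm_nonneg _) hMη0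
      _ ≤ Mη * (‖v z.1 z.2‖ ^ 2 * (C * ((1 + ‖c - z.2‖) ^ 4)⁻¹ * ‖e‖)) := by
          refine mul_le_mul_of_nonneg_left (mul_le_mul (norm_evalDiag_le _) ?_ (norm_nonneg _)
            (by positivity)) hMη0
          exact (ContinuousLinearMap.le_opNorm _ _).trans
            (mul_le_mul_of_nonneg_right (hC _) (norm_nonneg _))
      _ = Mη * (C * ‖e‖) * (((1 + ‖c - z.2‖) ^ 4)⁻¹ * ‖v z.1 z.2‖ ^ 2) := by ring

/-- **Integrability of the functional's integrand** on the slab. [folklore] -/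
theorem integrable_pgIntegrand (hv : IsLocalLeraySolutionOn T ν v₀ v π) (hδ : 0 < δ)
    (hη : Continuous η) (hηc : HasCompactSupport η) (hηT : tsupport η ⊆ Ioo 0 T)
    (c e : EuclideanSpace ℝ (Fin 3)) :
    Integrable (fun z : ℝ × EuclideanSpace ℝ (Fin 3) => η z.1 *
        (π z.1 z.2 * fderiv ℝ (Δ (newtonReg δ)) (c - z.2) e +
          evalDiag (v z.1 z.2) (fderiv ℝ (fderiv ℝ (fderiv ℝ (newtonReg δ))) (c - z.2) e)))
      (volume.restrict (Ioo (0 : ℝ) T ×ˢ (univ : Set (EuclideanSpace ℝ (Fin 3))))) := by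
  have h := (hv.integrable_pressure_term hδ hη hηc hηT (c := c) (c₀ := c) (r := δ) Subset.rfl e).add
    (hv.integrable_velocity_term hδ hη hηc c e)
  refine h.congr (Eventually.of_forall fun z => ?_)
  simp only [Pi.add_apply]
  ring

/-- **Continuity of the functional** `c ↦ ∫∫ η [π ∂ₑλ_δ(c - x) + D³Φ_δ(c - x)(e)(v,v)]`
(dominated convergence on the slab: near `c₀` the pressure term lives on the compact set
`tsupport η × B̄(c₀, δ + 1)` and the velocity term is `O((1 + |x - c₀|)⁻⁴ |v|²)`). [folklore] -/
theorem continuous_pgFunctional (hv : IsLocalLeraySolutionOn T ν v₀ v π) (hδ : 0 < δ)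
    (hη : Continuous η) (hηc : HasCompactSupport η) (hηT : tsupport η ⊆ Ioo 0 T)
    (e : EuclideanSpace ℝ (Fin 3)) :
    Continuous fun c : EuclideanSpace ℝ (Fin 3) =>
      ∫ z in Ioo (0 : ℝ) T ×ˢ (univ : Set (EuclideanSpace ℝ (Fin 3))), η z.1 *
        (π z.1 z.2 * fderiv ℝ (Δ (newtonReg δ)) (c - z.2) e +
          evalDiag (v z.1 z.2) (fderiv ℝ (fderiv ℝ (fderiv ℝ (newtonReg δ))) (c - z.2) e)) := by
  obtain ⟨M₀, M₁, M₂, -, hM₁0, -, -, hM₁, -⟩ := exists_bounds_laplacian_newtonReg hδ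
  obtain ⟨C, hC0, hC⟩ := exists_norm_fderiv3_newtonReg_le_inv hδ
  obtain ⟨Mη, hMη⟩ := hη.bounded_above_of_compact_support hηc
  have hMη0 : 0 ≤ Mη := (norm_nonneg _).trans (hMη 0)
  set μQ : Measure (ℝ × EuclideanSpace ℝ (Fin 3)) :=
    volume.restrict (Ioo (0 : ℝ) T ×ˢ (univ : Set (EuclideanSpace ℝ (Fin 3)))) with hμQ
  refine continuous_iff_continuousAt.2 fun c₀ => ?_
  -- the compact set carrying the pressure term near `c₀`
  set K : Set (ℝ × EuclideanSpace ℝ (Fin 3)) := tsupport η ×ˢ closedBall c₀ (δ + 1) with hK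
  have hKc : IsCompact K := hηc.isCompact.prod (isCompact_closedBall _ _)
  have hKQ : K ⊆ Ioo (0 : ℝ) T ×ˢ (univ : Set (EuclideanSpace ℝ (Fin 3))) :=
    prod_mono hηT (subset_univ _)
  have hπK : IntegrableOn (uncurry π) K volume :=
    hv.distributional.2.2.1.integrableOn_compact_subset hKQ hKc
  have hballs : ∀ c ∈ closedBall c₀ 1, closedBall c δ ⊆ closedBall c₀ (δ + 1) := by
    intro c hc y hy
    rw [mem_closedBall] at hc hy ⊢
    linarith [dist_triangle y c c₀]
  -- the dominating function
  set bound : ℝ × EuclideanSpace ℝ (Fin 3) → ℝ := fun z =>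
    Mη * (M₁ * ‖e‖) * ‖K.indicator (uncurry π) z‖ +
      Mη * (C * ‖e‖) * 16 * (((1 + ‖z.2 - c₀‖) ^ 4)⁻¹ * ‖v z.1 z.2‖ ^ 2) with hbound
  have hbint : Integrable bound μQ := by
    refine Integrable.add (Integrable.const_mul ?_ _)
      ((hv.integrable_slab_weight_mul_norm_sq c₀).const_mul _)
    have h1 : Integrable (K.indicator (uncurry π)) μQ :=
      ((hπK.integrable_indicator hKc.measurableSet).mono_measure Measure.restrict_le_self)
    exact h1.norm
  refine continuousAt_of_dominated (bound := bound) ?_ ?_ hbint ?_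
  · exact Eventually.of_forall fun c => (hv.integrable_pgIntegrand hδ hη hηc hηT c e).1
  · filter_upwards [closedBall_mem_nhds c₀ one_pos] with c hc
    refine Eventually.of_forall fun z => ?_
    rw [mul_add]
    refine (norm_add_le _ _).trans (add_le_add ?_ ?_)
    · -- the pressure term
      by_cases hz : z ∈ K
      · rw [indicator_of_mem hz, norm_mul, norm_mul]
        simp only [uncurry]
        calc ‖η z.1‖ * (‖π z.1 z.2‖ * ‖fderiv ℝ (Δ (newtonReg δ)) (c - z.2) e‖)
            ≤ Mη * (‖π z.1 z.2‖ * (M₁ * ‖e‖)) := by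
              refine mul_le_mul (hMη _) (mul_le_mul_of_nonneg_left ?_ (norm_nonneg _))
                (by positivity) hMη0
              exact (ContinuousLinearMap.le_opNorm _ _).trans
                (mul_le_mul_of_nonneg_right (hM₁ _) (norm_nonneg _))
          _ = Mη * (M₁ * ‖e‖) * ‖π z.1 z.2‖ := by ring
      · rw [pressure_term_eq_zero_of_notMem hδ (hballs c hc) π e hz, norm_zero]
        positivity
    · -- the velocity term
      have hcmp : ((1 + ‖c - z.2‖) ^ 4)⁻¹ ≤ 16 * ((1 + ‖c₀ - z.2‖) ^ 4)⁻¹ :=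
        inv_one_add_norm_pow_le_of_dist_le (x₀ := z.2) (y := c) (z := c₀)
          (by rw [dist_comm]; exact mem_closedBall.1 hc)
      rw [norm_mul, norm_sub_rev z.2 c₀]
      calc ‖η z.1‖ * ‖evalDiag (v z.1 z.2)
            (fderiv ℝ (fderiv ℝ (fderiv ℝ (newtonReg δ))) (c - z.2) e)‖
          ≤ Mη * (‖evalDiag (v z.1 z.2)‖ *
              ‖fderiv ℝ (fderiv ℝ (fderiv ℝ (newtonReg δ))) (c - z.2) e‖) :=
            mul_le_mul (hMη _) (ContinuousLinearMap.le_opNorm _ _) (norm_nonneg _) hMη0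
        _ ≤ Mη * (‖v z.1 z.2‖ ^ 2 * (C * (16 * ((1 + ‖c₀ - z.2‖) ^ 4)⁻¹) * ‖e‖)) := by
            refine mul_le_mul_of_nonneg_left (mul_le_mul (norm_evalDiag_le _) ?_ (norm_nonneg _)
              (by positivity)) hMη0
            refine (ContinuousLinearMap.le_opNorm _ _).trans (mul_le_mul_of_nonneg_right ?_ (norm_nonneg _))
            exact (hC _).trans (mul_le_mul_of_nonneg_left hcmp hC0)
        _ = Mη * (C * ‖e‖) * 16 * (((1 + ‖c₀ - z.2‖) ^ 4)⁻¹ * ‖v z.1 z.2‖ ^ 2) := by ring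
  · refine Eventually.of_forall fun z => ?_
    refine (continuous_const.mul (Continuous.add (continuous_const.mul ?_) ?_)).continuousAt
    · exact (((contDiff_laplacian_newtonReg hδ (n := 1)).continuous_fderiv one_ne_zero).comp
        (continuous_id.sub continuous_const)).clm_apply continuous_const
    · exact (evalDiag (v z.1 z.2)).continuous.comp ((((continuous_fderiv3_newtonReg δ).comp
        (continuous_id.sub continuous_const)).clm_apply continuous_const))

/-- **The functional as an iterated integral**: with `g_c(t) = ∫ [π(t) ∂ₑλ_δ(c - ·) + D³Φ_δ(c - ·)(e)(v(t), v(t))] dx`,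
`F(c) = ∫_{(0,T)} η(t) g_c(t) dt` (Fubini). [folklore] -/
theorem pgFunctional_eq_integral_integral (hv : IsLocalLeraySolutionOn T ν v₀ v π) (hδ : 0 < δ)
    (hη : Continuous η) (hηc : HasCompactSupport η) (hηT : tsupport η ⊆ Ioo 0 T)
    (c e : EuclideanSpace ℝ (Fin 3)) :
    ∫ z in Ioo (0 : ℝ) T ×ˢ (univ : Set (EuclideanSpace ℝ (Fin 3))), η z.1 *
        (π z.1 z.2 * fderiv ℝ (Δ (newtonReg δ)) (c - z.2) e +
          evalDiag (v z.1 z.2) (fderiv ℝ (fderiv ℝ (fderiv ℝ (newtonReg δ))) (c - z.2) e)) =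
      ∫ t in Ioo (0 : ℝ) T, η t * ∫ x, (π t x * fderiv ℝ (Δ (newtonReg δ)) (c - x) e +
          evalDiag (v t x) (fderiv ℝ (fderiv ℝ (fderiv ℝ (newtonReg δ))) (c - x) e)) := by
  have hint := hv.integrable_pgIntegrand hδ hη hηc hηT c e
  rw [volume_restrict_slab_eq_prod] at hint ⊢
  rw [integral_prod _ hint]
  refine integral_congr_ae (Eventually.of_forall fun t => ?_)
  simp only
  exact integral_const_mul (η t) _

end IsLocalLeraySolutionOn

end Functional

/-! ## The momentum equation against `η(t) λ_δ(c - x) e` -/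

section Momentum

variable {T ν : ℝ} {v₀ : EuclideanSpace ℝ (Fin 3) → EuclideanSpace ℝ (Fin 3)}
  {v : ℝ → EuclideanSpace ℝ (Fin 3) → EuclideanSpace ℝ (Fin 3)}
  {π : ℝ → EuclideanSpace ℝ (Fin 3) → ℝ} {δ : ℝ} {η : ℝ → ℝ}

/-- The translated bump times a constant vector is a test field on `ℝ³`. [folklore] -/
theorem isTestFunctionOn_laplacian_newtonReg_smul (hδ : 0 < δ) (c e : EuclideanSpace ℝ (Fin 3)) :
    FunctionSpaces.IsTestFunctionOn (⊤ : TopologicalSpace.Opens (EuclideanSpace ℝ (Fin 3)))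
      (fun x => Δ (newtonReg δ) (c - x) • e) where
  contDiff := ((contDiff_laplacian_newtonReg hδ).comp (contDiff_const.sub contDiff_id)).smul
    contDiff_const
  hasCompactSupport := by
    refine HasCompactSupport.intro (isCompact_closedBall c δ) fun x hx => ?_
    rw [mem_closedBall, dist_eq_norm, not_le, ← norm_sub_rev] at hx
    rw [laplacian_newtonReg_eq_zero hδ hx, zero_smul]
  tsupport_subset := by simp

/-- A continuous weight vanishing off a compact subset `K` of the slab times a function
integrable on `K` is integrable on the slab. [folklore] -/
theorem integrable_weight_mul_of_integrableOn {T : ℝ} {K : Set (ℝ × EuclideanSpace ℝ (Fin 3))}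
    (hK : IsCompact K) {Θ f : ℝ × EuclideanSpace ℝ (Fin 3) → ℝ} (hΘ : Continuous Θ)
    (h0 : ∀ z, z ∉ K → Θ z = 0) (hf : IntegrableOn f K volume) :
    Integrable (fun z => Θ z * f z)
      (volume.restrict (Ioo (0 : ℝ) T ×ˢ (univ : Set (EuclideanSpace ℝ (Fin 3))))) := by
  obtain ⟨M, hM⟩ := hΘ.bounded_above_of_compact_support (HasCompactSupport.intro hK h0)
  have hIK : IntegrableOn (fun z => Θ z * f z) K volume :=
    hf.bdd_mul hΘ.aestronglyMeasurable (ae_of_all _ hM)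
  exact (hIK.mono_measure Measure.restrict_le_self).integrable_of_forall_notMem_eq_zero
    fun z hz => by rw [h0 z hz, zero_mul]

namespace IsLocalLeraySolutionOn

/-- **The momentum equation tested with `Φ(t,x) = η(t) λ_δ(c - x) e`** (the one place where the
Navier–Stokes equations enter the route): for a local Leray solution on the slab,
`∫∫ η π ∂ₑλ_δ(c - x) = ∫∫ [η'(t) λ_δ(c-x) ⟨v,e⟩ - η(t) Dλ_δ(c-x)(v) ⟨v,e⟩ + ν η(t) Δλ_δ(c-x) ⟨v,e⟩]`
(`∂ₜΦ = η'λ_δ(c-·)e`, `(v·∇)Φ = -η Dλ_δ(c-·)(v) e`, `ΔΦ = η (Δλ_δ)(c-·) e`, `div Φ = -η ∂ₑλ_δ(c-·)`).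
[cite: KangMiuraTsai2020, Def. 3.1 (1) / Def. 3.2 (distributional Navier–Stokes on the slab)] -/
theorem pgFunctional_pressure_eq_momentum (hv : IsLocalLeraySolutionOn T ν v₀ v π) (hδ : 0 < δ)
    (hη : ContDiff ℝ (⊤ : ℕ∞) η) (hηc : HasCompactSupport η) (hηT : tsupport η ⊆ Ioo 0 T)
    (c e : EuclideanSpace ℝ (Fin 3)) :
    ∫ z in Ioo (0 : ℝ) T ×ˢ (univ : Set (EuclideanSpace ℝ (Fin 3))),
        η z.1 * (π z.1 z.2 * fderiv ℝ (Δ (newtonReg δ)) (c - z.2) e) =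
      ∫ z in Ioo (0 : ℝ) T ×ˢ (univ : Set (EuclideanSpace ℝ (Fin 3))),
        (deriv η z.1 * Δ (newtonReg δ) (c - z.2) * ⟪v z.1 z.2, e⟫ -
          η z.1 * fderiv ℝ (Δ (newtonReg δ)) (c - z.2) (v z.1 z.2) * ⟪v z.1 z.2, e⟫ +
          ν * (η z.1 * Δ (Δ (newtonReg δ)) (c - z.2)) * ⟪v z.1 z.2, e⟫) := by
  set lam : EuclideanSpace ℝ (Fin 3) → ℝ := Δ (newtonReg δ) with hlam
  have hlc : ContDiff ℝ (⊤ : ℕ∞) lam := contDiff_laplacian_newtonReg hδ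
  have hηc1 : Continuous η := hη.continuous
  have hηd : Differentiable ℝ η := hη.differentiable (by simp)
  -- the test field
  set ψ : ℝ → EuclideanSpace ℝ (Fin 3) → EuclideanSpace ℝ (Fin 3) :=
    fun s y => (η s * lam (c - y)) • e with hψ
  have hψtest : IsSpaceTimeTestOn (slab (EuclideanSpace ℝ (Fin 3)) (Ioo 0 T) isOpen_Ioo) ψ := by
    have h := isSpaceTimeTestOn_slab_smul isOpen_Ioo hη hηc hηT
      (isTestFunctionOn_laplacian_newtonReg_smul hδ c e)
    have e1 : (fun s x => η s • (Δ (newtonReg δ) (c - x) • e)) = ψ := by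
      funext s x
      rw [hψ, smul_smul]
    rwa [e1] at h
  -- pointwise calculus for the test field
  have hθd : ∀ (t : ℝ) (x : EuclideanSpace ℝ (Fin 3)),
      DifferentiableAt ℝ (fun y => η t * lam (c - y)) x := fun t x =>
    ((hlc.differentiable (by simp)).comp ((differentiable_const c).sub differentiable_id) x).const_mul _
  have hθ2 : ∀ t : ℝ, ContDiff ℝ 2 (fun y => η t * lam (c - y)) := fun t =>
    contDiff_const.mul ((contDiff_laplacian_newtonReg hδ (n := 2)).comp (contDiff_const.sub contDiff_id))
  have hfd : ∀ (t : ℝ) (x : EuclideanSpace ℝ (Fin 3)),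
      fderiv ℝ (fun y => η t * lam (c - y)) x = -(η t • fderiv ℝ lam (c - x)) := by
    intro t x
    have h1 : (fun y => η t * lam (c - y)) = fun y => η t • (fun w => lam (c - w)) y := rfl
    have hd : DifferentiableAt ℝ (fun w => lam (c - w)) x :=
      ((hlc.differentiable (by simp)).comp ((differentiable_const c).sub differentiable_id)) x
    rw [h1, fderiv_fun_const_smul hd, fderiv_comp_const_sub lam c x, smul_neg]
  have hlapθ : ∀ (t : ℝ) (x : EuclideanSpace ℝ (Fin 3)),
      Δ (fun y => η t * lam (c - y)) x = η t * Δ lam (c - x) := by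
    intro t x
    have h1 : (fun y => η t * lam (c - y)) = η t • fun w => lam (c - w) := rfl
    have h2 : ContDiffAt ℝ 2 (fun w => lam (c - w)) x :=
      ((contDiff_laplacian_newtonReg hδ (n := 2)).comp (contDiff_const.sub contDiff_id)).contDiffAt
    rw [h1, InnerProductSpace.laplacian_smul (η t) h2, laplacian_comp_const_sub lam c x, smul_eq_mul]
  have htime : ∀ (t : ℝ) (x : EuclideanSpace ℝ (Fin 3)),
      timeDeriv ψ t x = (deriv η t * lam (c - x)) • e := by
    intro t x
    rw [hψ, timeDeriv_smul_const (fun s y => η s * lam (c - y)) e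
      ((hηd t).mul_const _), timeDeriv_apply, deriv_mul_const (hηd t)]
  have hconv : ∀ (t : ℝ) (x : EuclideanSpace ℝ (Fin 3)),
      convect (v t) (ψ t) x = (-(η t * fderiv ℝ lam (c - x) (v t x))) • e := by
    intro t x
    rw [show ψ t = fun y => (η t * lam (c - y)) • e from rfl,
      convect_smul_const (v t) e (hθd t x), hfd t x]
    simp
  have hlap : ∀ (t : ℝ) (x : EuclideanSpace ℝ (Fin 3)),
      Δ (ψ t) x = (η t * Δ lam (c - x)) • e := by
    intro t x
    rw [show ψ t = fun y => (η t * lam (c - y)) • e from rfl, laplacian_smul_const (hθ2 t) e x,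
      hlapθ t x]
  have hdiv : ∀ (t : ℝ) (x : EuclideanSpace ℝ (Fin 3)),
      VectorCalculus.divergence (ψ t) x = -(η t * fderiv ℝ lam (c - x) e) := by
    intro t x
    rw [show ψ t = fun y => (η t * lam (c - y)) • e from rfl, divergence_smul_const e (hθd t x),
      hfd t x]
    simp
  -- the momentum equation, pointwise rewritten
  have hmom := hv.distributional.2.2.2.2 ψ hψtest
  rw [coe_slab_Ioo] at hmom
  have hpt : ∀ z : ℝ × EuclideanSpace ℝ (Fin 3),
      ⟪v z.1 z.2, timeDeriv ψ z.1 z.2⟫ + ⟪v z.1 z.2, convect (v z.1) (ψ z.1) z.2⟫ +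
        ν * ⟪v z.1 z.2, Δ (ψ z.1) z.2⟫ + π z.1 z.2 * VectorCalculus.divergence (ψ z.1) z.2 +
        ⟪(0 : ℝ → EuclideanSpace ℝ (Fin 3) → EuclideanSpace ℝ (Fin 3)) z.1 z.2, ψ z.1 z.2⟫ =
      (deriv η z.1 * lam (c - z.2) * ⟪v z.1 z.2, e⟫ -
          η z.1 * fderiv ℝ lam (c - z.2) (v z.1 z.2) * ⟪v z.1 z.2, e⟫ +
          ν * (η z.1 * Δ lam (c - z.2)) * ⟪v z.1 z.2, e⟫) -
        η z.1 * (π z.1 z.2 * fderiv ℝ lam (c - z.2) e) := by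
    intro z
    rw [htime, hconv, hlap, hdiv, real_inner_smul_right, real_inner_smul_right,
      real_inner_smul_right]
    simp only [Pi.zero_apply, inner_zero_left, add_zero]
    ring
  simp_rw [hpt] at hmom
  -- split the integral
  set K : Set (ℝ × EuclideanSpace ℝ (Fin 3)) := tsupport η ×ˢ closedBall c δ with hK
  have hKc : IsCompact K := hηc.isCompact.prod (isCompact_closedBall _ _)
  have hKQ : K ⊆ Ioo (0 : ℝ) T ×ˢ (univ : Set (EuclideanSpace ℝ (Fin 3))) :=
    prod_mono hηT (subset_univ _)
  have hvK : IntegrableOn (uncurry v) K volume :=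
    hv.distributional.1.integrableOn_compact_subset hKQ hKc
  have hv2K : IntegrableOn (fun z => ‖uncurry v z‖ ^ 2) K volume :=
    hv.distributional.2.1.integrableOn_compact_subset hKQ hKc
  have hveK : IntegrableOn (fun z : ℝ × EuclideanSpace ℝ (Fin 3) => ⟪v z.1 z.2, e⟫) K volume :=
    hvK.inner_const e
  have hoffK : ∀ z : ℝ × EuclideanSpace ℝ (Fin 3), z ∉ K → lam (c - z.2) = 0 ∧
      fderiv ℝ lam (c - z.2) = 0 ∧ Δ lam (c - z.2) = 0 ∨ η z.1 = 0 ∧ deriv η z.1 = 0 := by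
    intro z hz
    rw [hK, Set.mem_prod, not_and_or] at hz
    rcases hz with h | h
    · refine Or.inr ⟨image_eq_zero_of_notMem_tsupport h, ?_⟩
      have h' : z.1 ∉ tsupport (deriv η) := fun h' => h (tsupport_deriv_subset h')
      exact image_eq_zero_of_notMem_tsupport h'
    · left
      rw [mem_closedBall, dist_eq_norm, not_le, ← norm_sub_rev] at h
      refine ⟨laplacian_newtonReg_eq_zero hδ h, fderiv_laplacian_newtonReg_eq_zero hδ h, ?_⟩
      rw [hlam, (InnerProductSpace.laplacian_congr_nhds
        (laplacian_newtonReg_eventuallyEq_zero hδ h)).eq_of_nhds]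
      exact congrFun InnerProductSpace.laplacian_const _
  -- integrability of the three momentum terms and of the pressure term
  have hI1 : Integrable (fun z : ℝ × EuclideanSpace ℝ (Fin 3) =>
      deriv η z.1 * lam (c - z.2) * ⟪v z.1 z.2, e⟫)
      (volume.restrict (Ioo (0 : ℝ) T ×ˢ (univ : Set (EuclideanSpace ℝ (Fin 3))))) := by
    refine integrable_weight_mul_of_integrableOn hKc ?_ (fun z hz => ?_) hveK
    · exact ((hη.continuous_deriv (by simp)).comp continuous_fst).mul
        (hlc.continuous.comp (continuous_const.sub continuous_snd))
    · rcases hoffK z hz with ⟨h1, -, -⟩ | ⟨-, h2⟩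
      · rw [h1, mul_zero]
      · rw [h2, zero_mul]
  have hI3 : Integrable (fun z : ℝ × EuclideanSpace ℝ (Fin 3) =>
      ν * (η z.1 * Δ lam (c - z.2)) * ⟪v z.1 z.2, e⟫)
      (volume.restrict (Ioo (0 : ℝ) T ×ˢ (univ : Set (EuclideanSpace ℝ (Fin 3))))) := by
    refine integrable_weight_mul_of_integrableOn hKc ?_ (fun z hz => ?_) hveK
    · exact continuous_const.mul ((hηc1.comp continuous_fst).mul
        ((FluidPDE.continuous_laplacian (contDiff_laplacian_newtonReg hδ (n := 2))).comp
          (continuous_const.sub continuous_snd)))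
    · rcases hoffK z hz with ⟨-, -, h1⟩ | ⟨h2, -⟩
      · rw [h1, mul_zero, mul_zero]
      · rw [h2, zero_mul, mul_zero]
  have hI2 : Integrable (fun z : ℝ × EuclideanSpace ℝ (Fin 3) =>
      η z.1 * fderiv ℝ lam (c - z.2) (v z.1 z.2) * ⟪v z.1 z.2, e⟫)
      (volume.restrict (Ioo (0 : ℝ) T ×ˢ (univ : Set (EuclideanSpace ℝ (Fin 3))))) := by
    obtain ⟨M₀, M₁, M₂, -, hM₁0, -, -, hM₁, -⟩ := exists_bounds_laplacian_newtonReg hδ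
    obtain ⟨Mη, hMη⟩ := hηc1.bounded_above_of_compact_support hηc
    have hMη0 : 0 ≤ Mη := (norm_nonneg _).trans (hMη 0)
    -- measurability: a continuous function of `(z, v z)`
    have hΨ : Continuous fun p : (ℝ × EuclideanSpace ℝ (Fin 3)) × EuclideanSpace ℝ (Fin 3) =>
        η p.1.1 * fderiv ℝ lam (c - p.1.2) p.2 * ⟪p.2, e⟫ := by
      refine ((hηc1.comp (continuous_fst.comp continuous_fst)).mul ?_).mul
        (continuous_snd.inner continuous_const)
      exact isBoundedBilinearMap_apply.continuous.comp
        ((((hlc.continuous_fderiv (by simp)).comp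
          (continuous_const.sub (continuous_snd.comp continuous_fst))).prodMk continuous_snd))
    have hmeas : AEStronglyMeasurable (fun z : ℝ × EuclideanSpace ℝ (Fin 3) =>
        η z.1 * fderiv ℝ lam (c - z.2) (v z.1 z.2) * ⟪v z.1 z.2, e⟫)
        (volume.restrict (Ioo (0 : ℝ) T ×ˢ (univ : Set (EuclideanSpace ℝ (Fin 3))))) :=
      hΨ.comp_aestronglyMeasurable (aestronglyMeasurable_id.prodMk hv.aestronglyMeasurable)
    have hdom : Integrable (fun z => Mη * M₁ * ‖e‖ * K.indicator (fun z => ‖uncurry v z‖ ^ 2) z)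
        (volume.restrict (Ioo (0 : ℝ) T ×ˢ (univ : Set (EuclideanSpace ℝ (Fin 3))))) :=
      ((hv2K.integrable_indicator hKc.measurableSet).mono_measure Measure.restrict_le_self).const_mul _
    refine Integrable.mono' hdom hmeas (Eventually.of_forall fun z => ?_)
    by_cases hz : z ∈ K
    · rw [indicator_of_mem hz, norm_mul, norm_mul]
      simp only [uncurry]
      calc ‖η z.1‖ * ‖fderiv ℝ lam (c - z.2) (v z.1 z.2)‖ * ‖⟪v z.1 z.2, e⟫‖
          ≤ Mη * (M₁ * ‖v z.1 z.2‖) * (‖v z.1 z.2‖ * ‖e‖) := by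
            refine mul_le_mul (mul_le_mul (hMη _) ?_ (norm_nonneg _) hMη0) (norm_inner_le_norm _ _)
              (norm_nonneg _) (by positivity)
            exact (ContinuousLinearMap.le_opNorm _ _).trans
              (mul_le_mul_of_nonneg_right (hM₁ _) (norm_nonneg _))
        _ = Mη * M₁ * ‖e‖ * ‖v z.1 z.2‖ ^ 2 := by ring
    · rw [indicator_of_notMem hz, mul_zero]
      rcases hoffK z hz with ⟨-, h1, -⟩ | ⟨h2, -⟩
      · rw [h1]; simp
      · rw [h2]; simp
  have hIπ := hv.integrable_pressure_term hδ hηc1 hηc hηT (c := c) (c₀ := c) (r := δ) Subset.rfl e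
  -- conclude
  have hA : Integrable (fun z : ℝ × EuclideanSpace ℝ (Fin 3) =>
      deriv η z.1 * lam (c - z.2) * ⟪v z.1 z.2, e⟫ -
        η z.1 * fderiv ℝ lam (c - z.2) (v z.1 z.2) * ⟪v z.1 z.2, e⟫ +
        ν * (η z.1 * Δ lam (c - z.2)) * ⟪v z.1 z.2, e⟫)
      (volume.restrict (Ioo (0 : ℝ) T ×ˢ (univ : Set (EuclideanSpace ℝ (Fin 3))))) :=
    (hI1.sub hI2).add hI3
  have h3 := (integral_sub hA hIπ).symm.trans hmom
  exact (sub_eq_zero.1 h3).symm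

end IsLocalLeraySolutionOn

end Momentum

/-! ## Decay at spatial infinity -/

section Decay

variable {T ν : ℝ} {v₀ : EuclideanSpace ℝ (Fin 3) → EuclideanSpace ℝ (Fin 3)}
  {v : ℝ → EuclideanSpace ℝ (Fin 3) → EuclideanSpace ℝ (Fin 3)}
  {π : ℝ → EuclideanSpace ℝ (Fin 3) → ℝ} {δ : ℝ} {η : ℝ → ℝ}

/-- A real function dominated (eventually) by the real part of an `ℝ≥0∞`-valued function tending to
`0` tends to `0`. [folklore] -/
theorem tendsto_zero_of_norm_le_toReal {α : Type*} {l : Filter α} {G : α → ℝ} {Φ : α → ℝ≥0∞}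
    (h : ∀ᶠ a in l, ‖G a‖ ≤ (Φ a).toReal) (hΦ : Tendsto Φ l (𝓝 0)) : Tendsto G l (𝓝 0) := by
  have h1 : Tendsto (fun a => (Φ a).toReal) l (𝓝 0) := by
    have := (ENNReal.tendsto_toReal ENNReal.zero_ne_top).comp hΦ
    rwa [ENNReal.toReal_zero] at this
  exact squeeze_zero_norm' h h1

/-- Boxes: `(0,T) × B_L(c)` inside the slab, with the product measure. [folklore] -/
theorem lintegral_box_eq_lintegral_lintegral (T : ℝ) {F : ℝ × EuclideanSpace ℝ (Fin 3) → ℝ≥0∞}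
    (hF : AEMeasurable F (((volume : Measure ℝ).restrict (Ioo 0 T)).prod volume))
    (S : Set (EuclideanSpace ℝ (Fin 3))) :
    ∫⁻ z in Ioo (0 : ℝ) T ×ˢ S, F z =
      ∫⁻ t in Ioo (0 : ℝ) T, ∫⁻ x in S, F (t, x) := by
  have hprod : (((volume : Measure ℝ).restrict (Ioo 0 T)).prod (volume.restrict S)) =
      volume.restrict (Ioo (0 : ℝ) T ×ˢ S) := by
    rw [Measure.prod_restrict, ← Measure.volume_eq_prod]
  rw [← hprod, lintegral_prod]
  exact hF.mono_measure (Measure.prod_mono le_rfl Measure.restrict_le_self)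

namespace IsLocalLeraySolutionOn

/-- **Decay of the weighted energy** `∫∫_{(0,T)×ℝ³} |v|² (1 + |x - c|)⁻⁴ → 0` as `|c| → ∞`, for a
local Leray solution on the slab: split `|x - c| < L` (Jia–Šverák's decay clause (7)) and
`|x - c| ≥ L` (the uniformly local tail `|B_1|⁻¹ A 16 ∫_{|z| ≥ L-1} |z|⁻⁴`, small for `L` large).
[cite: KangMiuraTsai2020, Def. 3.2 (2), (7)] -/
theorem tendsto_lintegral_slab_weight_cocompact (hv : IsLocalLeraySolutionOn T ν v₀ v π) :
    Tendsto (fun c : EuclideanSpace ℝ (Fin 3) =>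
      ∫⁻ z in Ioo (0 : ℝ) T ×ˢ (univ : Set (EuclideanSpace ℝ (Fin 3))),
        ‖v z.1 z.2‖ₑ ^ 2 * ENNReal.ofReal (((1 + ‖z.2 - c‖) ^ 4)⁻¹))
      (cocompact (EuclideanSpace ℝ (Fin 3))) (𝓝 0) := by
  obtain ⟨A, hA⟩ := hv.uniformLocalEnergy 1 one_pos
  set μt : Measure ℝ := volume.restrict (Ioo (0 : ℝ) T) with hμt
  set V1 : ℝ≥0∞ := volume (ball (0 : EuclideanSpace ℝ (Fin 3)) 1) with hV1
  set Tail : ℝ → ℝ≥0∞ := fun L => V1⁻¹ * ((A : ℝ≥0∞) *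
    (16 * ∫⁻ z in (ball (0 : EuclideanSpace ℝ (Fin 3)) (L - 1))ᶜ, RieszKernel.powKer 4 z)) with hTail
  have hvm := hv.aestronglyMeasurable_prod
  have hmeas := hv.ae_aestronglyMeasurable_slice'
  -- pointwise splitting of the weight at radius `L ≥ 2`
  have hsplit : ∀ (L : ℝ), 2 ≤ L → ∀ (c x : EuclideanSpace ℝ (Fin 3)) (a : ℝ≥0∞),
      a * ENNReal.ofReal (((1 + ‖x - c‖) ^ 4)⁻¹) ≤
        (ball c L).indicator (fun _ => a) x +
          (ball c L)ᶜ.indicator (fun x => a * RieszKernel.powKer 4 (x - c)) x := by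
    intro L hL c x a
    by_cases hx : x ∈ ball c L
    · rw [indicator_of_mem hx, indicator_of_notMem (by exact fun h => h hx), add_zero]
      refine (mul_le_mul' le_rfl (ENNReal.ofReal_le_one.2 ?_)).trans_eq (mul_one a)
      exact inv_le_one_of_one_le₀ (one_le_pow₀ (by linarith [norm_nonneg (x - c)]))
    · rw [indicator_of_notMem hx, zero_add, indicator_of_mem (mem_compl hx)]
      refine mul_le_mul' le_rfl ?_
      rw [RieszKernel.powKer_apply]
      have hxc : L ≤ ‖x - c‖ := by rwa [mem_ball, dist_eq_norm, not_lt] at hx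
      have hpos : 0 < ‖x - c‖ := by linarith
      refine ENNReal.ofReal_le_ofReal ?_
      rw [Real.rpow_neg hpos.le, show (4 : ℝ) = ((4 : ℕ) : ℝ) by norm_num, Real.rpow_natCast]
      exact inv_anti₀ (by positivity) (pow_le_pow_left₀ hpos.le (by linarith) 4)
  -- the bound `Ψ(c) ≤ J(c, L) + Tail(L) |(0,T)|`
  have hbound : ∀ (L : ℝ), 2 ≤ L → ∀ c : EuclideanSpace ℝ (Fin 3),
      ∫⁻ z in Ioo (0 : ℝ) T ×ˢ (univ : Set (EuclideanSpace ℝ (Fin 3))),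
          ‖v z.1 z.2‖ₑ ^ 2 * ENNReal.ofReal (((1 + ‖z.2 - c‖) ^ 4)⁻¹) ≤
        (∫⁻ z in Ioo (0 : ℝ) T ×ˢ ball c L, ‖v z.1 z.2‖ₑ ^ 2) + Tail L * volume (Ioo (0 : ℝ) T) := by
    intro L hL c
    have hF : AEMeasurable (fun z : ℝ × EuclideanSpace ℝ (Fin 3) =>
        ‖v z.1 z.2‖ₑ ^ 2 * ENNReal.ofReal (((1 + ‖z.2 - c‖) ^ 4)⁻¹)) (μt.prod volume) :=
      (hvm.enorm.pow_const 2).mul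
        ((measurable_ofReal_inv_one_add_norm_sub_pow c).comp measurable_snd).aemeasurable
    have hF2 : AEMeasurable (fun z : ℝ × EuclideanSpace ℝ (Fin 3) => ‖v z.1 z.2‖ₑ ^ 2)
        (μt.prod volume) := hvm.enorm.pow_const 2
    rw [volume_restrict_slab_eq_prod, lintegral_prod _ hF,
      lintegral_box_eq_lintegral_lintegral T hF2 _]
    have hslice : ∀ᵐ t ∂μt,
        ∫⁻ x, ‖v t x‖ₑ ^ 2 * ENNReal.ofReal (((1 + ‖x - c‖) ^ 4)⁻¹) ≤
          (∫⁻ x in ball c L, ‖v t x‖ₑ ^ 2) + Tail L := by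
      filter_upwards [hA, hmeas] with t hAt hmt
      have hg : AEMeasurable (fun x => ‖v t x‖ₑ ^ 2) volume := hmt.enorm.pow_const 2
      calc ∫⁻ x, ‖v t x‖ₑ ^ 2 * ENNReal.ofReal (((1 + ‖x - c‖) ^ 4)⁻¹)
          ≤ ∫⁻ x, ((ball c L).indicator (fun x => ‖v t x‖ₑ ^ 2) x +
              (ball c L)ᶜ.indicator (fun x => ‖v t x‖ₑ ^ 2 * RieszKernel.powKer 4 (x - c)) x) :=
            lintegral_mono fun x => hsplit L hL c x _
        _ = (∫⁻ x in ball c L, ‖v t x‖ₑ ^ 2) +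
              ∫⁻ x in (ball c L)ᶜ, ‖v t x‖ₑ ^ 2 * RieszKernel.powKer 4 (x - c) := by
            rw [lintegral_add_left' (hg.indicator measurableSet_ball),
              lintegral_indicator measurableSet_ball, lintegral_indicator measurableSet_ball.compl]
        _ ≤ (∫⁻ x in ball c L, ‖v t x‖ₑ ^ 2) + Tail L :=
            add_le_add le_rfl (lintegral_compl_ball_mul_powKer_le hg hAt c hL)
    calc ∫⁻ t, (∫⁻ x : EuclideanSpace ℝ (Fin 3),
          ‖v t x‖ₑ ^ 2 * ENNReal.ofReal (((1 + ‖x - c‖) ^ 4)⁻¹)) ∂μt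
        ≤ ∫⁻ t, ((∫⁻ x in ball c L, ‖v t x‖ₑ ^ 2) + Tail L) ∂μt := lintegral_mono_ae hslice
      _ = (∫⁻ t, (∫⁻ x in ball c L, ‖v t x‖ₑ ^ 2) ∂μt) + Tail L * volume (Ioo (0 : ℝ) T) := by
          rw [lintegral_add_right _ measurable_const, lintegral_const, hμt,
            Measure.restrict_apply_univ]
  -- `Tail(L) |(0,T)| → 0`
  have hIT : volume (Ioo (0 : ℝ) T) ≠ ⊤ := by rw [Real.volume_Ioo]; exact ENNReal.ofReal_ne_top
  have hV10 : V1 ≠ 0 := (measure_ball_pos volume _ one_pos).ne'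
  have hTail0 : Tendsto (fun L => Tail L * volume (Ioo (0 : ℝ) T)) atTop (𝓝 0) := by
    have h1 : Tendsto (fun L : ℝ => ∫⁻ z in (ball (0 : EuclideanSpace ℝ (Fin 3)) (L - 1))ᶜ,
        RieszKernel.powKer 4 z) atTop (𝓝 0) :=
      tendsto_lintegral_compl_ball_powKer_four_atTop.comp (tendsto_atTop_add_const_right _ (-1)
        tendsto_id)
    have h2 : Tendsto Tail atTop (𝓝 0) := by
      have h3 := ENNReal.Tendsto.const_mul (a := V1⁻¹ * (A : ℝ≥0∞) * 16) h1
        (Or.inr (ENNReal.mul_ne_top (ENNReal.mul_ne_top (ENNReal.inv_ne_top.2 hV10)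
          ENNReal.coe_ne_top) (by norm_num)))
      rw [mul_zero] at h3
      refine h3.congr fun L => ?_
      simp only [hTail]
      ring
    have h4 := ENNReal.Tendsto.mul_const h2 (Or.inr hIT)
    rwa [zero_mul] at h4
  -- conclusion
  refine ENNReal.tendsto_nhds_zero.2 fun ε hε => ?_
  have hε2 : ε / 2 ≠ 0 := (ENNReal.half_pos hε.ne').ne'
  obtain ⟨L₀, hL₀⟩ := (ENNReal.tendsto_nhds_zero.1 hTail0 (ε / 2) (ENNReal.half_pos hε.ne')).exists_forall_of_atTop
  set L : ℝ := max L₀ 2 with hL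
  have hL2 : 2 ≤ L := le_max_right _ _
  have hdec := ENNReal.tendsto_nhds_zero.1 (hv.decay L (by linarith)) (ε / 2) (ENNReal.half_pos hε.ne')
  filter_upwards [hdec] with c hc
  calc _ ≤ (∫⁻ z in Ioo (0 : ℝ) T ×ˢ ball c L, ‖v z.1 z.2‖ₑ ^ 2) + Tail L * volume (Ioo (0 : ℝ) T) :=
        hbound L hL2 c
    _ ≤ ε / 2 + ε / 2 := add_le_add hc (hL₀ L (le_max_left _ _))
    _ = ε := ENNReal.add_halves ε

/-- **Decay of the velocity term of the functional**: `∫∫ η D³Φ_δ(c - x)(e)(v, v) → 0` as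
`|c| → ∞`. [folklore] -/
theorem tendsto_velocity_term_cocompact (hv : IsLocalLeraySolutionOn T ν v₀ v π) (hδ : 0 < δ)
    (hη : Continuous η) (hηc : HasCompactSupport η) (e : EuclideanSpace ℝ (Fin 3)) :
    Tendsto (fun c : EuclideanSpace ℝ (Fin 3) =>
      ∫ z in Ioo (0 : ℝ) T ×ˢ (univ : Set (EuclideanSpace ℝ (Fin 3))), η z.1 *
        evalDiag (v z.1 z.2) (fderiv ℝ (fderiv ℝ (fderiv ℝ (newtonReg δ))) (c - z.2) e))
      (cocompact (EuclideanSpace ℝ (Fin 3))) (𝓝 0) := by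
  obtain ⟨C, hC0, hC⟩ := exists_norm_fderiv3_newtonReg_le_inv hδ
  obtain ⟨Mη, hMη⟩ := hη.bounded_above_of_compact_support hηc
  have hMη0 : 0 ≤ Mη := (norm_nonneg _).trans (hMη 0)
  obtain ⟨Cw, hCwtop, hCw⟩ := exists_lintegral_mul_inv_one_add_norm_pow_le
  obtain ⟨A, hA⟩ := hv.uniformLocalEnergy 1 one_pos
  have hIT : volume (Ioo (0 : ℝ) T) ≠ ⊤ := by rw [Real.volume_Ioo]; exact ENNReal.ofReal_ne_top
  set Ψ : EuclideanSpace ℝ (Fin 3) → ℝ≥0∞ := fun c =>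
    ∫⁻ z in Ioo (0 : ℝ) T ×ˢ (univ : Set (EuclideanSpace ℝ (Fin 3))),
      ‖v z.1 z.2‖ₑ ^ 2 * ENNReal.ofReal (((1 + ‖z.2 - c‖) ^ 4)⁻¹) with hΨ
  have hΨ0 : Tendsto (fun c => ENNReal.ofReal (Mη * (C * ‖e‖)) * Ψ c)
      (cocompact (EuclideanSpace ℝ (Fin 3))) (𝓝 0) := by
    have h := ENNReal.Tendsto.const_mul (a := ENNReal.ofReal (Mη * (C * ‖e‖)))
      hv.tendsto_lintegral_slab_weight_cocompact (Or.inr ENNReal.ofReal_ne_top)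
    rwa [mul_zero] at h
  refine tendsto_zero_of_norm_le_toReal (Eventually.of_forall fun c => ?_) hΨ0
  refine (norm_integral_le_lintegral_norm _).trans (ENNReal.toReal_mono ?_ ?_)
  · exact ENNReal.mul_ne_top ENNReal.ofReal_ne_top
      (ne_top_of_le_ne_top (ENNReal.mul_ne_top (ENNReal.mul_ne_top hCwtop ENNReal.coe_ne_top) hIT)
        (hv.lintegral_slab_weight_mul_le hCw hA c))
  · rw [hΨ, ← lintegral_const_mul' _ _ ENNReal.ofReal_ne_top]
    refine lintegral_mono fun z => ?_
    rw [← ofReal_norm, ← ENNReal.ofReal_pow (norm_nonneg _),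
      ← ENNReal.ofReal_mul (by positivity), ← ENNReal.ofReal_mul (by positivity)]
    refine ENNReal.ofReal_le_ofReal ?_
    rw [norm_mul, norm_sub_rev z.2 c]
    calc ‖η z.1‖ * ‖evalDiag (v z.1 z.2) (fderiv ℝ (fderiv ℝ (fderiv ℝ (newtonReg δ))) (c - z.2) e)‖
        ≤ Mη * (‖evalDiag (v z.1 z.2)‖ *
            ‖fderiv ℝ (fderiv ℝ (fderiv ℝ (newtonReg δ))) (c - z.2) e‖) :=
          mul_le_mul (hMη _) (ContinuousLinearMap.le_opNorm _ _) (norm_nonneg _) hMη0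
      _ ≤ Mη * (‖v z.1 z.2‖ ^ 2 * (C * ((1 + ‖c - z.2‖) ^ 4)⁻¹ * ‖e‖)) := by
          refine mul_le_mul_of_nonneg_left (mul_le_mul (norm_evalDiag_le _) ?_ (norm_nonneg _)
            (by positivity)) hMη0
          exact (ContinuousLinearMap.le_opNorm _ _).trans
            (mul_le_mul_of_nonneg_right (hC _) (norm_nonneg _))
      _ = Mη * (C * ‖e‖) * (‖v z.1 z.2‖ ^ 2 * ((1 + ‖c - z.2‖) ^ 4)⁻¹) := by ring

/-- **Decay of the momentum terms**: `∫∫ [η'λ_δ(c-x)⟨v,e⟩ - η Dλ_δ(c-x)(v)⟨v,e⟩ + ν η Δλ_δ(c-x)⟨v,e⟩] → 0`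
as `|c| → ∞` (the integrand lives on `(0,T) × B_{δ+1}(c)` and is `O(|v| + |v|²)`; Cauchy–Schwarz
for the linear part and the decay clause (7)). [cite: KangMiuraTsai2020, Def. 3.2 (7)] -/
theorem tendsto_momentum_terms_cocompact (hv : IsLocalLeraySolutionOn T ν v₀ v π) (hδ : 0 < δ)
    (hη : ContDiff ℝ (⊤ : ℕ∞) η) (hηc : HasCompactSupport η) (e : EuclideanSpace ℝ (Fin 3)) :
    Tendsto (fun c : EuclideanSpace ℝ (Fin 3) =>
      ∫ z in Ioo (0 : ℝ) T ×ˢ (univ : Set (EuclideanSpace ℝ (Fin 3))),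
        (deriv η z.1 * Δ (newtonReg δ) (c - z.2) * ⟪v z.1 z.2, e⟫ -
          η z.1 * fderiv ℝ (Δ (newtonReg δ)) (c - z.2) (v z.1 z.2) * ⟪v z.1 z.2, e⟫ +
          ν * (η z.1 * Δ (Δ (newtonReg δ)) (c - z.2)) * ⟪v z.1 z.2, e⟫))
      (cocompact (EuclideanSpace ℝ (Fin 3))) (𝓝 0) := by
  obtain ⟨M₀, M₁, M₂, hM₀0, hM₁0, hM₂0, hM₀, hM₁, hM₂⟩ := exists_bounds_laplacian_newtonReg hδ
  have hηc1 : Continuous η := hη.continuous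
  obtain ⟨Mη, hMη⟩ := hηc1.bounded_above_of_compact_support hηc
  obtain ⟨Mη', hMη'⟩ := (hη.continuous_deriv (by simp)).bounded_above_of_compact_support hηc.deriv
  have hMη0 : 0 ≤ Mη := (norm_nonneg _).trans (hMη 0)
  have hMη'0 : 0 ≤ Mη' := (norm_nonneg _).trans (hMη' 0)
  set lam : EuclideanSpace ℝ (Fin 3) → ℝ := Δ (newtonReg δ) with hlam
  set μt : Measure ℝ := volume.restrict (Ioo (0 : ℝ) T) with hμt
  have hvm := hv.aestronglyMeasurable_prod
  -- constants
  set C₁ : ℝ := Mη' * M₀ * ‖e‖ + |ν| * Mη * M₂ * ‖e‖ with hC₁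
  set C₂ : ℝ := Mη * M₁ * ‖e‖ with hC₂
  have hC₁0 : 0 ≤ C₁ := by positivity
  have hC₂0 : 0 ≤ C₂ := by positivity
  -- the boxes and the two functionals
  set J₁ : EuclideanSpace ℝ (Fin 3) → ℝ≥0∞ := fun c =>
    ∫⁻ z in Ioo (0 : ℝ) T ×ˢ ball c (δ + 1), ‖v z.1 z.2‖ₑ with hJ₁
  set J₂ : EuclideanSpace ℝ (Fin 3) → ℝ≥0∞ := fun c =>
    ∫⁻ z in Ioo (0 : ℝ) T ×ˢ ball c (δ + 1), ‖v z.1 z.2‖ₑ ^ 2 with hJ₂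
  set Vb : ℝ≥0∞ := volume (Ioo (0 : ℝ) T ×ˢ ball (0 : EuclideanSpace ℝ (Fin 3)) (δ + 1)) with hVb
  have hVbtop : Vb ≠ ⊤ := by
    rw [hVb, Measure.volume_eq_prod, Measure.prod_prod, Real.volume_Ioo]
    exact ENNReal.mul_ne_top ENNReal.ofReal_ne_top measure_ball_lt_top.ne
  have hvol : ∀ c : EuclideanSpace ℝ (Fin 3),
      volume (Ioo (0 : ℝ) T ×ˢ ball c (δ + 1)) = Vb := fun c => by
    rw [hVb, Measure.volume_eq_prod, Measure.prod_prod, Measure.prod_prod,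
      Measure.addHaar_ball_center volume c]
  -- Cauchy–Schwarz: `J₁ ≤ Vb^{1/2} J₂^{1/2}`
  have hCS : ∀ c, J₁ c ≤ Vb ^ (1 / 2 : ℝ) * J₂ c ^ (1 / 2 : ℝ) := by
    intro c
    set μb := (volume : Measure (ℝ × EuclideanSpace ℝ (Fin 3))).restrict
      (Ioo (0 : ℝ) T ×ˢ ball c (δ + 1)) with hμb
    have hgm : AEMeasurable (fun z : ℝ × EuclideanSpace ℝ (Fin 3) => ‖v z.1 z.2‖ₑ) μb := by
      have h1 : AEStronglyMeasurable (uncurry v) μb :=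
        hv.aestronglyMeasurable.mono_measure
          (Measure.restrict_mono (prod_mono Subset.rfl (subset_univ _)) le_rfl)
      exact h1.enorm
    have h := ENNReal.lintegral_mul_le_Lp_mul_Lq μb Real.HolderConjugate.two_two
      aemeasurable_const hgm (f := fun _ => 1)
    simp only [Pi.mul_apply, one_mul, ENNReal.one_rpow, lintegral_const] at h
    rw [hμb, Measure.restrict_apply_univ, hvol c] at h
    refine h.trans (le_of_eq ?_)
    congr 2
    refine lintegral_congr fun z => ?_
    rw [show (2 : ℝ) = ((2 : ℕ) : ℝ) by norm_num, ENNReal.rpow_natCast]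
  -- `J₂ → 0`, hence `C₁ J₁ + C₂ J₂ → 0`
  have hJ₂0 : Tendsto J₂ (cocompact (EuclideanSpace ℝ (Fin 3))) (𝓝 0) := hv.decay (δ + 1) (by linarith)
  have hJ₁0 : Tendsto J₁ (cocompact (EuclideanSpace ℝ (Fin 3))) (𝓝 0) := by
    have h1 : Tendsto (fun c => Vb ^ (1 / 2 : ℝ) * J₂ c ^ (1 / 2 : ℝ))
        (cocompact (EuclideanSpace ℝ (Fin 3))) (𝓝 0) := by
      have h2 : Tendsto (fun c => J₂ c ^ (1 / 2 : ℝ)) (cocompact (EuclideanSpace ℝ (Fin 3)))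
          (𝓝 0) := by
        have := ((ENNReal.continuous_rpow_const (y := (1 / 2 : ℝ))).tendsto 0).comp hJ₂0
        rwa [ENNReal.zero_rpow_of_pos (by norm_num)] at this
      have h3 := ENNReal.Tendsto.const_mul (a := Vb ^ (1 / 2 : ℝ)) h2
        (Or.inr (ENNReal.rpow_ne_top_of_nonneg (by norm_num) hVbtop))
      rwa [mul_zero] at h3
    exact tendsto_of_tendsto_of_tendsto_of_le_of_le tendsto_const_nhds h1 (fun _ => bot_le) hCS
  have hsum : Tendsto (fun c => ENNReal.ofReal C₁ * J₁ c + ENNReal.ofReal C₂ * J₂ c)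
      (cocompact (EuclideanSpace ℝ (Fin 3))) (𝓝 0) := by
    have h1 := ENNReal.Tendsto.const_mul (a := ENNReal.ofReal C₁) hJ₁0 (Or.inr ENNReal.ofReal_ne_top)
    have h2 := ENNReal.Tendsto.const_mul (a := ENNReal.ofReal C₂) hJ₂0 (Or.inr ENNReal.ofReal_ne_top)
    rw [mul_zero] at h1 h2
    simpa using h1.add h2
  -- finiteness of the bound
  have hJ₂top : ∀ c, J₂ c ≠ ⊤ := fun c => ne_top_of_le_ne_top
    (hv.sqIntegrable (closedBall c (δ + 1)) (isCompact_closedBall _ _)).ne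
    (lintegral_mono_set (prod_mono Subset.rfl ball_subset_closedBall))
  have hJ₁top : ∀ c, J₁ c ≠ ⊤ := fun c => ne_top_of_le_ne_top
    (ENNReal.mul_ne_top (ENNReal.rpow_ne_top_of_nonneg (by norm_num) hVbtop)
      (ENNReal.rpow_ne_top_of_nonneg (by norm_num) (hJ₂top c))) (hCS c)
  -- the pointwise bound on the integrand
  set G : ℝ × EuclideanSpace ℝ (Fin 3) → ℝ≥0∞ := fun z =>
    ENNReal.ofReal C₁ * ‖v z.1 z.2‖ₑ + ENNReal.ofReal C₂ * ‖v z.1 z.2‖ₑ ^ 2 with hG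
  have hpt : ∀ (c : EuclideanSpace ℝ (Fin 3)) (z : ℝ × EuclideanSpace ℝ (Fin 3)),
      ENNReal.ofReal ‖deriv η z.1 * lam (c - z.2) * ⟪v z.1 z.2, e⟫ -
          η z.1 * fderiv ℝ lam (c - z.2) (v z.1 z.2) * ⟪v z.1 z.2, e⟫ +
          ν * (η z.1 * Δ lam (c - z.2)) * ⟪v z.1 z.2, e⟫‖ ≤
        ((univ : Set ℝ) ×ˢ ball c (δ + 1)).indicator G z := by
    intro c z
    by_cases hz : z.2 ∈ ball c (δ + 1)
    · rw [indicator_of_mem (mem_prod.2 ⟨mem_univ _, hz⟩), hG]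
      dsimp only
      rw [← ofReal_norm, ← ENNReal.ofReal_pow (norm_nonneg _),
        ← ENNReal.ofReal_mul hC₁0, ← ENNReal.ofReal_mul hC₂0, ← ENNReal.ofReal_add (by positivity)
          (by positivity)]
      refine ENNReal.ofReal_le_ofReal ?_
      have hin : ‖⟪v z.1 z.2, e⟫‖ ≤ ‖v z.1 z.2‖ * ‖e‖ := norm_inner_le_norm _ _
      have h1 : ‖deriv η z.1 * lam (c - z.2) * ⟪v z.1 z.2, e⟫‖ ≤ Mη' * M₀ * ‖e‖ * ‖v z.1 z.2‖ := by
        rw [norm_mul, norm_mul]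
        calc ‖deriv η z.1‖ * ‖lam (c - z.2)‖ * ‖⟪v z.1 z.2, e⟫‖
            ≤ Mη' * M₀ * (‖v z.1 z.2‖ * ‖e‖) :=
              mul_le_mul (mul_le_mul (hMη' _) (hM₀ _) (norm_nonneg _) hMη'0) hin (norm_nonneg _)
                (by positivity)
          _ = Mη' * M₀ * ‖e‖ * ‖v z.1 z.2‖ := by ring
      have h2 : ‖η z.1 * fderiv ℝ lam (c - z.2) (v z.1 z.2) * ⟪v z.1 z.2, e⟫‖ ≤
          Mη * M₁ * ‖e‖ * ‖v z.1 z.2‖ ^ 2 := by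
        rw [norm_mul, norm_mul]
        calc ‖η z.1‖ * ‖fderiv ℝ lam (c - z.2) (v z.1 z.2)‖ * ‖⟪v z.1 z.2, e⟫‖
            ≤ Mη * (M₁ * ‖v z.1 z.2‖) * (‖v z.1 z.2‖ * ‖e‖) := by
              refine mul_le_mul (mul_le_mul (hMη _) ?_ (norm_nonneg _) hMη0) hin (norm_nonneg _)
                (by positivity)
              exact (ContinuousLinearMap.le_opNorm _ _).trans
                (mul_le_mul_of_nonneg_right (hM₁ _) (norm_nonneg _))
          _ = Mη * M₁ * ‖e‖ * ‖v z.1 z.2‖ ^ 2 := by ring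
      have h3 : ‖ν * (η z.1 * Δ lam (c - z.2)) * ⟪v z.1 z.2, e⟫‖ ≤
          |ν| * Mη * M₂ * ‖e‖ * ‖v z.1 z.2‖ := by
        rw [norm_mul, norm_mul, norm_mul, Real.norm_eq_abs]
        calc |ν| * (‖η z.1‖ * ‖Δ lam (c - z.2)‖) * ‖⟪v z.1 z.2, e⟫‖
            ≤ |ν| * (Mη * M₂) * (‖v z.1 z.2‖ * ‖e‖) :=
              mul_le_mul (mul_le_mul_of_nonneg_left (mul_le_mul (hMη _) (hM₂ _) (norm_nonneg _)
                hMη0) (abs_nonneg _)) hin (norm_nonneg _) (by positivity)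
          _ = |ν| * Mη * M₂ * ‖e‖ * ‖v z.1 z.2‖ := by ring
      calc _ ≤ ‖deriv η z.1 * lam (c - z.2) * ⟪v z.1 z.2, e⟫ -
              η z.1 * fderiv ℝ lam (c - z.2) (v z.1 z.2) * ⟪v z.1 z.2, e⟫‖ +
            ‖ν * (η z.1 * Δ lam (c - z.2)) * ⟪v z.1 z.2, e⟫‖ := norm_add_le _ _
        _ ≤ (‖deriv η z.1 * lam (c - z.2) * ⟪v z.1 z.2, e⟫‖ +
              ‖η z.1 * fderiv ℝ lam (c - z.2) (v z.1 z.2) * ⟪v z.1 z.2, e⟫‖) +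
            ‖ν * (η z.1 * Δ lam (c - z.2)) * ⟪v z.1 z.2, e⟫‖ :=
            add_le_add (norm_sub_le _ _) le_rfl
        _ ≤ (Mη' * M₀ * ‖e‖ * ‖v z.1 z.2‖ + Mη * M₁ * ‖e‖ * ‖v z.1 z.2‖ ^ 2) +
            |ν| * Mη * M₂ * ‖e‖ * ‖v z.1 z.2‖ := add_le_add (add_le_add h1 h2) h3
        _ = C₁ * ‖v z.1 z.2‖ + C₂ * ‖v z.1 z.2‖ ^ 2 := by rw [hC₁, hC₂]; ring
    · have hz' : δ < ‖c - z.2‖ := by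
        rw [mem_ball, dist_eq_norm, not_lt, ← norm_sub_rev] at hz
        linarith
      have e0 : lam (c - z.2) = 0 := laplacian_newtonReg_eq_zero hδ hz'
      have e1 : fderiv ℝ lam (c - z.2) = 0 := fderiv_laplacian_newtonReg_eq_zero hδ hz'
      have e2 : Δ lam (c - z.2) = 0 := by
        rw [hlam, (InnerProductSpace.laplacian_congr_nhds
          (laplacian_newtonReg_eventuallyEq_zero hδ hz')).eq_of_nhds]
        exact congrFun InnerProductSpace.laplacian_const _
      rw [e0, e1, e2]
      simp
  -- the bound on the integral
  have hle : ∀ c : EuclideanSpace ℝ (Fin 3),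
      ‖∫ z in Ioo (0 : ℝ) T ×ˢ (univ : Set (EuclideanSpace ℝ (Fin 3))),
        (deriv η z.1 * lam (c - z.2) * ⟪v z.1 z.2, e⟫ -
          η z.1 * fderiv ℝ lam (c - z.2) (v z.1 z.2) * ⟪v z.1 z.2, e⟫ +
          ν * (η z.1 * Δ lam (c - z.2)) * ⟪v z.1 z.2, e⟫)‖ ≤
      (ENNReal.ofReal C₁ * J₁ c + ENNReal.ofReal C₂ * J₂ c).toReal := by
    intro c
    refine (norm_integral_le_lintegral_norm _).trans (ENNReal.toReal_mono ?_ ?_)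
    · exact ENNReal.add_ne_top.2 ⟨ENNReal.mul_ne_top ENNReal.ofReal_ne_top (hJ₁top c),
        ENNReal.mul_ne_top ENNReal.ofReal_ne_top (hJ₂top c)⟩
    · calc ∫⁻ z in Ioo (0 : ℝ) T ×ˢ (univ : Set (EuclideanSpace ℝ (Fin 3))), ENNReal.ofReal
            ‖deriv η z.1 * lam (c - z.2) * ⟪v z.1 z.2, e⟫ -
              η z.1 * fderiv ℝ lam (c - z.2) (v z.1 z.2) * ⟪v z.1 z.2, e⟫ +
              ν * (η z.1 * Δ lam (c - z.2)) * ⟪v z.1 z.2, e⟫‖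
          ≤ ∫⁻ z in Ioo (0 : ℝ) T ×ˢ (univ : Set (EuclideanSpace ℝ (Fin 3))),
              ((univ : Set ℝ) ×ˢ ball c (δ + 1)).indicator G z := lintegral_mono (hpt c)
        _ = ∫⁻ z in Ioo (0 : ℝ) T ×ˢ ball c (δ + 1), G z := by
            rw [lintegral_indicator (MeasurableSet.univ.prod measurableSet_ball),
              Measure.restrict_restrict (MeasurableSet.univ.prod measurableSet_ball),
              Set.prod_inter_prod, univ_inter, inter_univ]
        _ = ENNReal.ofReal C₁ * J₁ c + ENNReal.ofReal C₂ * J₂ c := by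
            have h1 : AEMeasurable (fun z : ℝ × EuclideanSpace ℝ (Fin 3) => ‖v z.1 z.2‖ₑ)
                ((volume : Measure (ℝ × EuclideanSpace ℝ (Fin 3))).restrict
                  (Ioo (0 : ℝ) T ×ˢ ball c (δ + 1))) :=
              (hv.aestronglyMeasurable.mono_measure (Measure.restrict_mono
                (prod_mono Subset.rfl (subset_univ _)) le_rfl)).enorm
            simp only [hG]
            rw [lintegral_add_left' (h1.const_mul _), lintegral_const_mul'' _ h1,
              lintegral_const_mul'' _ (h1.pow_const 2)]
  exact tendsto_zero_of_norm_le_toReal (Eventually.of_forall hle) hsum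

/-- **Decay of the functional at spatial infinity**: `F(c) → 0` as `|c| → ∞` for the mollified
pressure-gradient functional of a local Leray solution on the slab (momentum terms by
`tendsto_momentum_terms_cocompact` after `pgFunctional_pressure_eq_momentum`, velocity term by
`tendsto_velocity_term_cocompact`). [cite: KangMiuraTsai2020, Def. 3.2 (7)] -/
theorem tendsto_pgFunctional_cocompact (hv : IsLocalLeraySolutionOn T ν v₀ v π) (hδ : 0 < δ)
    (hη : ContDiff ℝ (⊤ : ℕ∞) η) (hηc : HasCompactSupport η) (hηT : tsupport η ⊆ Ioo 0 T)
    (e : EuclideanSpace ℝ (Fin 3)) :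
    Tendsto (fun c : EuclideanSpace ℝ (Fin 3) =>
      ∫ z in Ioo (0 : ℝ) T ×ˢ (univ : Set (EuclideanSpace ℝ (Fin 3))), η z.1 *
        (π z.1 z.2 * fderiv ℝ (Δ (newtonReg δ)) (c - z.2) e +
          evalDiag (v z.1 z.2) (fderiv ℝ (fderiv ℝ (fderiv ℝ (newtonReg δ))) (c - z.2) e)))
      (cocompact (EuclideanSpace ℝ (Fin 3))) (𝓝 0) := by
  have hηc1 : Continuous η := hη.continuous
  have h := (hv.tendsto_momentum_terms_cocompact hδ hη hηc e).add
    (hv.tendsto_velocity_term_cocompact hδ hηc1 hηc e)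
  rw [add_zero] at h
  refine h.congr fun c => ?_
  rw [← hv.pgFunctional_pressure_eq_momentum hδ hη hηc hηT c e,
    ← integral_add (hv.integrable_pressure_term hδ hηc1 hηc hηT (c := c) (c₀ := c) (r := δ)
      Subset.rfl e) (hv.integrable_velocity_term hδ hηc1 hηc c e)]
  refine integral_congr_ae (Eventually.of_forall fun z => ?_)
  simp only [mul_add]

end IsLocalLeraySolutionOn

end Decay

end Literature.Analysis.FluidPDE
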